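/-
Copyright (c) 2026 the pub-hodgecm-mathlib formalisation cell (harness21).  Prover seat hodgecm-mathlib-K2E3-p05 (g2), Track B «K2-LIT», engine E3, unit U4 «Keys»,
2026-09-04.  KERNEL module: THEOREMS ONLY (no definition, no named fact, no `sorry`, no instance, no notation).
-/
import Summits.HodgeConjecture.HodgeConjecture.Theorems.K2E3ParahoricAverageK0          -- ★ II-2a (this seat's lineage): `toFun_apply_of_mem_I`; brings ★ II-1, ★ PS-LEVELS, FILE C, ★ avgProj, ★ BruhatIwahoriThree
import HarnessLib

/-!
# K2 ∕ E3 «EllipticInputs», unit U4 «Keys» — Road II of MEMO `hK-KeysThmTwo`, stub II-2 (second half) «THE `K₁`-AVERAGE ON THE IWAHORI PLANE»: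
# `e_{K₁}(x f₁ + y f_w) = [K₁:I]⁻¹ (([K₁:I] − 1) x + μ y) · (f₁ + μ⁻¹ f_w)`, `μ = (χδ_B^{1∕2})(d)`, for an unramified principal series of `U(Φ₃)(L⁺_v)`, `v` inert
# [Casselman1980 §3; BernsteinZelevinsky1976 §2.3 (the idempotent `e_K`); BruhatTits1972 (4.4.3)–(4.4.4) (`K₁ = I ⊔ I·dw·I`); Tits1979 §3.3.2]

Cell hodgecm-mathlib (D-0151), FLOOR 0, Track B «K2-LIT», engine E3, crux item H413 = stmt-HodgeConjecture-24833 (route `HCCMUnconditional`, no route verbs); target BY NAME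
`…K2E3EllipticInputs.U4Keys.sig_K2E3KeysThmTwoContracting` (U4-f, U4Keys ED. 3), unramified first rung (Road II); abstract core ★ `K2E3ParahoricReducibilityCriterion` (p855172),
vectors ★ `K2E3PSIwahoriBasis` (II-1, p855550), `K₀`-form ★ `K2E3ParahoricAverageK0` (II-2a, p855830).  Author K2E3-p05 (g2).  `--supports stmt-HodgeConjecture-24833 --as helper`;
THEOREMS ONLY; letters of ★ (G3)-EXPLICIT ∕ ★ PS-LEVELS (`w hw eA heA hd g₁ hg₁ K0 K1 I hK0 hK1 hI`).

THE MATHEMATICS.  `χ` unramified, `V = i_G(χ)`, `(f₁, f_w)` the Iwahori pair of ★ II-1, `d ∈ B_v` any Borel element with `d·w̃ ∈ K₁` (★ `exists_borel_mul_weyl_mem_K1`),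
`μ := χ(proj d)·δ_B^{1∕2}(d)`, `e₁ := f₁ + μ⁻¹ f_w` (so `V^{K₁} = ℂ e₁`, `e₁(1) = 1`, ★ II-1).  For an `I`-fixed `f` and `r ∈ K₁` there are exactly two cases:
(B) `r ∈ (d w̃)·I`: then `f(r) = f(d w̃ i) = σ_χ(d) f(w̃ i) = μ f(w̃)`; (C) `r ∉ (d w̃)·I`: by Bruhat–Iwahori `r = h·g·κ` (`h ∈ B_v`, `κ ∈ I`, `g ∈ {1, w̃}`, ★ FILE C `cover_borel_I`),
and the cell `g = w̃` is EXCLUDED — THE CELL TEST (§1, in the model `U(σ, Φ₃)(L_w)`): if `b w κ ∈ K₁` with `b ∈ B` then `x := (t w)⁻¹ (b w κ) κ⁻¹ = w⁻¹(t⁻¹b)w` (for the torus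
`t` with `t w ∈ K₁`) lies in `K₁` and is LOWER triangular (its `(0,2)`, `(1,2)` entries vanish), and an element of `K₁ = Stab(diag(1,1,ϖ)·𝒪³)` with vanishing `(0,2)`, `(1,2)`
entries is integral with `(2,0)` entry in `𝔭`, hence in `I` by ★ FILE 1's Hermitian upgrade — so `r ∈ (d w̃)·I` after all.  Hence in case (C) `r = h κ` with
`h = r κ⁻¹ ∈ B ∩ K₁`, where the inducing line is trivial (★ PS-LEVELS `inducingLine_eq_one_of_mem_K1`), and `f(r) = f(κ) = f(1)`.  Summing over a left transversal `R′`
of `K₁ ∕ I` (exactly ONE member in the coset `(d w̃)·I`): `Σ_r v(r) = (|R′| − 1)·x + μ·y` for `v = x f₁ + y f_w`, and `e_{K₁} v = (e_{K₁} v)(1)·e₁` (★ II-1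
`eq_smul_of_mem_fixedPoints_K1`) gives **`e_{K₁}(x f₁ + y f_w) = |R′|⁻¹ ((|R′| − 1) x + μ y)·(f₁ + μ⁻¹ f_w)`** — the `K₁`-form `(a₁ : b₁) = ([K₁:I] − 1 : μ)`, `e₁ = f₁ + μ⁻¹ f_w`
of ★ p855172's criterion (`[K₁ : I] = q + 1` at an inert place, ★ `UnitaryLatticeTreeLevelIndices`; left to the assembly II-4).  No cell enumeration of `I·dw̃·I` is needed.
§1 (model) `mem_inf_of_mem_conj_glInt_of_apply_eq_zero`, `inv_mul_mem_inf_of_mem_borelU` (THE CELL TEST) · §2 (carrier) `toFun_apply_of_inv_mul_mem_I` (case (B)),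
`inv_mul_mem_I_of_eq_borel_mul_weyl_mul`, `toFun_apply_of_inv_mul_not_mem_I` (case (C)) · §3 `card_filter_inv_mul_mem_I_eq_one` · §4 `avgProj_K1_eq` (the formula).
HONEST LABEL: HC_CM is proved only modulo the 7 printed citations (2 remaining named inputs: hLiu418 = stmt-HodgeConjecture-24832, h413 = stmt-HodgeConjecture-24833)
until rung 0 closes; count-neutral (stub II-2b of a first rung of the row-#5 residue; no printed citation is discharged).

## References
* [Casselman1980] W. Casselman, Compositio Math. 40 (1980), §3.  * [BernsteinZelevinsky1976] I. N. Bernstein, A. V. Zelevinsky, Russian Math. Surveys 31:3 (1976), §2.3.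
* [BruhatTits1972] Publ. Math. IHÉS 41 (1972), (4.4.3)–(4.4.4). * [Tits1979] PSPM 33.1, §3.3.2, §3.7. * [Rogawski1990] Ann. of Math. Stud. 123, §4.5, §12.2. * [Keys1984] Compositio 51, §7 Thm (2).
-/

set_option autoImplicit false
-- the mandated namespace has the single-problem summit's repeated segment (`HodgeConjecture.HodgeConjecture`)
set_option linter.dupNamespace false

noncomputable section

open NumberField IsDedekindDomain MeasureTheory
open scoped Matrix MatrixGroups NNReal WithZero BigOperators
open Literature.NumberTheory.Automorphic Literature.NumberTheory.Automorphic.UnitaryGroup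
open Literature.NumberTheory.Rogawski1990 Literature.NumberTheory.GaloisRepresentations

namespace Summit.HodgeConjecture.HodgeConjecture.Cruxes.H413.K2E3ParahoricAverageK1

open Summit.HodgeConjecture.HodgeConjecture.Cruxes.H413
open Summit.HodgeConjecture.HodgeConjecture.Cruxes.H413.F0P3cStCharTSStLevelsTransport
open Summit.HodgeConjecture.HodgeConjecture.Cruxes.H413.F0P3cStCharTSPSLevelsCells
open Summit.HodgeConjecture.HodgeConjecture.Cruxes.H413.K2E3PSIwahoriBasis
open Summit.HodgeConjecture.HodgeConjecture.Cruxes.H413.K2E3ParahoricAverageK0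

/-! ## §1 The cell test in the model `U(σ, Φ₃)(K)` -/

section Model

variable {K : Type*} [Field K] [Valued K ℤᵐ⁰] [ValuativeRel K] [(Valued.v : Valuation K ℤᵐ⁰).Compatible]
  (σ : K →+* K) {ϖ : K} {J : Matrix (Fin 3) (Fin 3) K} (hJ : J = (StdForm.antidiagonal 3).over K)
  (hvσ : ∀ a, Valued.v (σ a) = Valued.v a) (hvϖ : Valued.v ϖ = WithZero.exp (-1 : ℤ))
  (g₁ : GL (Fin 3) K) (hg₁ : (g₁ : Matrix (Fin 3) (Fin 3) K) = Matrix.diagonal ![(1 : K), 1, ϖ])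

include hJ hvσ hvϖ hg₁ in
/-- **An element of `K₁` whose `(0,2)` and `(1,2)` entries vanish lies in `I = K₀ ⊓ K₁`.**  Membership in `K₁ = Stab(g₁𝒪³)` says `g₁⁻¹ x g₁` is integral, i.e.
`|x₂₀|, |x₂₁| < 1` and `|xᵢⱼ| ≤ 1` for the other entries except `(0,2), (1,2)` (which may lie in `𝔭⁻¹`); when those two vanish `x` is integral with `|x₂₀| < 1`, and
★ FILE 1's Hermitian upgrade `mem_glInt_inf_conj_glInt_of_v_lt_one` puts it in `I`. [cite: BruhatTits1972, (4.4.3)–(4.4.4)] [cite: Tits1979, §3.7] -/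
theorem mem_inf_of_mem_conj_glInt_of_apply_eq_zero {x : ↥(unitaryGroupOfForm σ J)}
    (hx : x ∈ ((glInt 3 K).map (MulAut.conj g₁).toMonoidHom).subgroupOf (unitaryGroupOfForm σ J))
    (h02 : ((x : GL (Fin 3) K) : Matrix (Fin 3) (Fin 3) K) 0 2 = 0) (h12 : ((x : GL (Fin 3) K) : Matrix (Fin 3) (Fin 3) K) 1 2 = 0) :
    x ∈ (glInt 3 K).subgroupOf (unitaryGroupOfForm σ J) ⊓ ((glInt 3 K).map (MulAut.conj g₁).toMonoidHom).subgroupOf (unitaryGroupOfForm σ J) := by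
  have hϖ0 : ϖ ≠ 0 := CartanUnique.uniformizer_ne_zero hvϖ
  have key : ∀ y : K, Valued.v (ϖ⁻¹ * y) ≤ 1 ↔ Valued.v y < 1 := v_uniformiser_inv_mul_le_one_iff hvϖ
  have hint := ((Literature.NumberTheory.Automorphic.mem_glInt_iff_forall_v_le_one _).1 ((mem_conj_glInt_subgroupOf_iff σ g₁ x).1 hx)).1
  have hent : ∀ i j, Valued.v ((![(1 : K), 1, ϖ] i)⁻¹ * ((x : GL (Fin 3) K) : Matrix (Fin 3) (Fin 3) K) i j * ![(1 : K), 1, ϖ] j) ≤ 1 := fun i j => by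
    rw [← coe_conj_apply_of_eq g₁ hg₁ hϖ0]; exact hint i j
  have h20 : Valued.v (((x : GL (Fin 3) K) : Matrix (Fin 3) (Fin 3) K) 2 0) < 1 := by
    have h := hent 2 0
    simp only [Matrix.cons_val_zero, Matrix.cons_val, mul_one] at h
    exact (key _).1 h
  have h21 : Valued.v (((x : GL (Fin 3) K) : Matrix (Fin 3) (Fin 3) K) 2 1) < 1 := by
    have h := hent 2 1
    simp only [Matrix.cons_val_one, Matrix.cons_val, mul_one] at h
    exact (key _).1 h
  refine mem_glInt_inf_conj_glInt_of_v_lt_one σ hJ hvσ hvϖ g₁ hg₁ ?_ h20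
  rw [mem_glInt_subgroupOf_iff σ hJ hvσ]
  have hϖϖ : ∀ y : K, ϖ⁻¹ * y * ϖ = y := fun y => by rw [mul_comm, ← mul_assoc, mul_inv_cancel₀ hϖ0, one_mul]
  intro i j
  fin_cases i <;> fin_cases j
  · simpa using hent 0 0
  · simpa using hent 0 1
  · simp [h02]
  · simpa using hent 1 0
  · simpa using hent 1 1
  · simp [h12]
  · exact h20.le
  · exact h21.le
  · simpa [hϖϖ] using hent 2 2

include hJ hvσ hvϖ hg₁ in
/-- **THE CELL TEST for `K₁`.**  Let `t w ∈ K₁` with `t ∈ B` (★ `exists_mem_torusU_mul_weylLongU_mem_conj_glInt`: `t = diag(ϖ⁻¹, 1, σϖ)`), `b ∈ B`, `κ ∈ I` and suppose the point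
`b·w·κ` of the big Bruhat–Iwahori cell lies in `K₁`.  Then `(t w)⁻¹ (b w κ) ∈ I`, i.e. `b w κ ∈ (t w)·I`: the element `x = w⁻¹ (t⁻¹ b) w = (t w)⁻¹ (b w κ) κ⁻¹` lies in `K₁` and is lower
triangular (`w = w⁻¹` reverses rows and columns of the upper triangular `t⁻¹ b`), so the previous lemma applies.  «`K₁ ∩ B·w·I = d w̃·I`: the cell `I·dw̃·I` of `K₁ = I ⊔ I dw̃ I` is a
single right `I`-coset up to the Borel.» [cite: BruhatTits1972, (4.4.3)] [cite: Tits1979, §3.3.2] [cite: Casselman1980, §3] -/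
theorem inv_mul_mem_inf_of_mem_borelU {t b κ : ↥(unitaryGroupOfForm σ J)} (ht : t ∈ borelU σ J) (hb : b ∈ borelU σ J)
    (htw : t * weylLongU σ hJ ∈ ((glInt 3 K).map (MulAut.conj g₁).toMonoidHom).subgroupOf (unitaryGroupOfForm σ J))
    (hκ : κ ∈ (glInt 3 K).subgroupOf (unitaryGroupOfForm σ J) ⊓ ((glInt 3 K).map (MulAut.conj g₁).toMonoidHom).subgroupOf (unitaryGroupOfForm σ J))
    (hk : b * weylLongU σ hJ * κ ∈ ((glInt 3 K).map (MulAut.conj g₁).toMonoidHom).subgroupOf (unitaryGroupOfForm σ J)) :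
    (t * weylLongU σ hJ)⁻¹ * (b * weylLongU σ hJ * κ) ∈
      (glInt 3 K).subgroupOf (unitaryGroupOfForm σ J) ⊓ ((glInt 3 K).map (MulAut.conj g₁).toMonoidHom).subgroupOf (unitaryGroupOfForm σ J) := by
  have hw : weylLongU σ hJ * weylLongU σ hJ = 1 := weylLongU_mul_weylLongU σ hJ
  have hw' : (weylLongU σ hJ)⁻¹ = weylLongU σ hJ := inv_eq_of_mul_eq_one_right hw
  -- `x = w (t⁻¹ b) w`
  have hx : (t * weylLongU σ hJ)⁻¹ * (b * weylLongU σ hJ * κ) = weylLongU σ hJ * (t⁻¹ * b) * weylLongU σ hJ * κ := by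
    rw [mul_inv_rev, hw']; simp only [mul_assoc]
  have hxK1 : weylLongU σ hJ * (t⁻¹ * b) * weylLongU σ hJ ∈ ((glInt 3 K).map (MulAut.conj g₁).toMonoidHom).subgroupOf (unitaryGroupOfForm σ J) := by
    have e : weylLongU σ hJ * (t⁻¹ * b) * weylLongU σ hJ = (t * weylLongU σ hJ)⁻¹ * (b * weylLongU σ hJ * κ) * κ⁻¹ := by
      rw [hx, mul_inv_cancel_right]
    rw [e]
    exact Subgroup.mul_mem _ (Subgroup.mul_mem _ (Subgroup.inv_mem _ htw) hk) (Subgroup.inv_mem _ (Subgroup.mem_inf.1 hκ).2)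
  have hup : (((t⁻¹ * b : ↥(unitaryGroupOfForm σ J)) : GL (Fin 3) K) : Matrix (Fin 3) (Fin 3) K).BlockTriangular id :=
    (mem_borelU_iff (t⁻¹ * b)).1 (Subgroup.mul_mem _ (Subgroup.inv_mem _ ht) hb)
  have h02 : (((weylLongU σ hJ * (t⁻¹ * b) * weylLongU σ hJ : ↥(unitaryGroupOfForm σ J)) : GL (Fin 3) K) : Matrix (Fin 3) (Fin 3) K) 0 2 = 0 := by
    rw [coe_weylLongU_mul_mul_weylLongU_apply']; exact hup (by decide)
  have h12 : (((weylLongU σ hJ * (t⁻¹ * b) * weylLongU σ hJ : ↥(unitaryGroupOfForm σ J)) : GL (Fin 3) K) : Matrix (Fin 3) (Fin 3) K) 1 2 = 0 := by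
    rw [coe_weylLongU_mul_mul_weylLongU_apply']; exact hup (by decide)
  rw [hx]
  exact Subgroup.mul_mem _ (mem_inf_of_mem_conj_glInt_of_apply_eq_zero σ hJ hvσ hvϖ g₁ hg₁ hxK1 h02 h12) hκ

end Model

/-! ## §2 Values of an `I`-fixed vector on `K₁ = (K₁ ∖ dw̃·I) ⊔ dw̃·I` -/

variable (L : Type) [Field L] [NumberField L] [IsCMField L] (v : HeightOneSpectrum (𝓞 ↥(maximalRealSubfield L)))
  (w : PlacesOver L v) (hw : IsCMField.complexConj L • w.1 = w.1)
  (eA : Gqs L v ≃ₜ* ↥(unitaryGroupOfForm (galAdicCompletionMap (L := L) (IsCMField.complexConj L) hw) ((StdForm.antidiagonal 3).over (w.1.adicCompletion L))))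
  (heA : ∀ g : Gqs L v,
    ((eA g : ↥(unitaryGroupOfForm (galAdicCompletionMap (L := L) (IsCMField.complexConj L) hw) ((StdForm.antidiagonal 3).over (w.1.adicCompletion L)))) : GL (Fin 3) (w.1.adicCompletion L)) =
      ((localNonsplitEquiv (IsCMField.complexConj L) (qsForm L) (IsCMField.complexConj_ne_one L) w hw g :
        ↥(unitaryGroupOfForm (galAdicCompletionMap (L := L) (IsCMField.complexConj L) hw) (placeForm (qsForm L) w.1))) : GL (Fin 3) (w.1.adicCompletion L)))

set_option maxHeartbeats 3200000 in
set_option synthInstance.maxHeartbeats 400000 in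
-- instance-path unification between `Gqs L v` and the literal carrier of ★ `cmPrincipalSeries` (class of ★ PS-LEVELS)
/-- **Case (B): on the coset `(d w̃)·I` an `I`-fixed vector takes the value `μ·f(w̃)`**, `μ = χ(proj d)·δ_B^{1∕2}(d)`: for `r = d w̃ i`, `f(r) = σ_χ(d)·f(w̃ i) = μ·(i·f)(w̃) = μ f(w̃)`.
(No unramifiedness needed.) [cite: Casselman1980, §3] [cite: BruhatTits1972, (4.4.3)] -/
theorem toFun_apply_of_inv_mul_mem_I (I : Subgroup (Gqs L v))
    (χ : ↥(torusU (conjLocal L (IsCMField.complexConj L) v) (cmLocalForm L 3 v)) →* ℂˣ) (d : ↥(cmBorelTriple L 3 v).P) :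
    haveI := locallyCompactSpace_cmBorelU L 3 v
    ∀ (f : Representation.SmoothInd (cmBorelTriple L 3 v).P
        (Representation.twist (((Representation.trivial ℂ ↥(torusU (conjLocal L (IsCMField.complexConj L) v) (cmLocalForm L 3 v)) ℂ).twist χ).comp
          (cmBorelTriple L 3 v).proj) (rootDeltaChar (cmBorelTriple L 3 v).P))), f ∈ (cmPrincipalSeries L 3 v χ).fixedPoints I →
      ∀ r : ↥(unitaryGroupOfForm (conjLocal L (IsCMField.complexConj L) v) (cmLocalForm L 3 v)),
        ((d : ↥(unitaryGroupOfForm (conjLocal L (IsCMField.complexConj L) v) (cmLocalForm L 3 v))) * (![(1 : ↥(unitaryGroupOfForm (conjLocal L (IsCMField.complexConj L) v) (cmLocalForm L 3 v))), eA.symm (weylLongU (galAdicCompletionMap (L := L) (IsCMField.complexConj L) hw) (rfl : (StdForm.antidiagonal 3).over (w.1.adicCompletion L) = _))] 1))⁻¹ * r ∈ I →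
        f.toFun r = (((χ ((cmBorelTriple L 3 v).proj d) : ℂˣ) : ℂ) * ((rootDeltaChar (cmBorelTriple L 3 v).P d : ℂˣ) : ℂ)) *
          f.toFun (eA.symm (weylLongU (galAdicCompletionMap (L := L) (IsCMField.complexConj L) hw) (rfl : (StdForm.antidiagonal 3).over (w.1.adicCompletion L) = _))) := by
  haveI := locallyCompactSpace_cmBorelU L 3 v
  intro f hf r hi
  have hr_eq : r = (d : ↥(unitaryGroupOfForm (conjLocal L (IsCMField.complexConj L) v) (cmLocalForm L 3 v))) *
      ((![(1 : ↥(unitaryGroupOfForm (conjLocal L (IsCMField.complexConj L) v) (cmLocalForm L 3 v))), eA.symm (weylLongU (galAdicCompletionMap (L := L) (IsCMField.complexConj L) hw) (rfl : (StdForm.antidiagonal 3).over (w.1.adicCompletion L) = _))] 1) *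
        (((d : ↥(unitaryGroupOfForm (conjLocal L (IsCMField.complexConj L) v) (cmLocalForm L 3 v))) * (![(1 : ↥(unitaryGroupOfForm (conjLocal L (IsCMField.complexConj L) v) (cmLocalForm L 3 v))), eA.symm (weylLongU (galAdicCompletionMap (L := L) (IsCMField.complexConj L) hw) (rfl : (StdForm.antidiagonal 3).over (w.1.adicCompletion L) = _))] 1))⁻¹ * r)) := by
    simp only [mul_inv_rev, ← mul_assoc, mul_inv_cancel, one_mul]
  -- `f(w̃ i) = (i·f)(w̃) = f(w̃)`
  have e2 : (cmPrincipalSeries L 3 v χ (((d : ↥(unitaryGroupOfForm (conjLocal L (IsCMField.complexConj L) v) (cmLocalForm L 3 v))) * (![(1 : ↥(unitaryGroupOfForm (conjLocal L (IsCMField.complexConj L) v) (cmLocalForm L 3 v))), eA.symm (weylLongU (galAdicCompletionMap (L := L) (IsCMField.complexConj L) hw) (rfl : (StdForm.antidiagonal 3).over (w.1.adicCompletion L) = _))] 1))⁻¹ * r) f).toFun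
      (![(1 : ↥(unitaryGroupOfForm (conjLocal L (IsCMField.complexConj L) v) (cmLocalForm L 3 v))), eA.symm (weylLongU (galAdicCompletionMap (L := L) (IsCMField.complexConj L) hw) (rfl : (StdForm.antidiagonal 3).over (w.1.adicCompletion L) = _))] 1) =
      f.toFun ((![(1 : ↥(unitaryGroupOfForm (conjLocal L (IsCMField.complexConj L) v) (cmLocalForm L 3 v))), eA.symm (weylLongU (galAdicCompletionMap (L := L) (IsCMField.complexConj L) hw) (rfl : (StdForm.antidiagonal 3).over (w.1.adicCompletion L) = _))] 1) *
        (((d : ↥(unitaryGroupOfForm (conjLocal L (IsCMField.complexConj L) v) (cmLocalForm L 3 v))) * (![(1 : ↥(unitaryGroupOfForm (conjLocal L (IsCMField.complexConj L) v) (cmLocalForm L 3 v))), eA.symm (weylLongU (galAdicCompletionMap (L := L) (IsCMField.complexConj L) hw) (rfl : (StdForm.antidiagonal 3).over (w.1.adicCompletion L) = _))] 1))⁻¹ * r)) :=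
    Representation.toFun_smoothIndRep_apply _ f _
  rw [(Representation.mem_fixedPoints _ _ _).1 hf _ hi] at e2
  rw [hr_eq, Representation.SmoothInd.toFun_subgroup_mul f d, F0P2nFrobeniusFunctional.twist_comp_proj_character_apply (cmBorelTriple L 3 v) χ d, ← e2]
  simp only [Matrix.cons_val_one, Matrix.cons_val_fin_one, mul_assoc]

include heA in
set_option maxHeartbeats 3200000 in
set_option synthInstance.maxHeartbeats 400000 in
-- instance-path unification between `Gqs L v` and the model group through `eA` (class of FILE C)
/-- **The cell test read through `eA`**: if `h·w̃·κ ∈ K₁` with `h ∈ B_v`, `κ ∈ I`, then `(d w̃)⁻¹ (h w̃ κ) ∈ I` for any Borel `d` with `d w̃ ∈ K₁` (§1 `inv_mul_mem_inf_of_mem_borelU` in the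
model, ★ FILE C `eA_mem_borelU_iff` ∕ `mem_comap_iff` ∕ `eA_vec`). [cite: BruhatTits1972, (4.4.3)] [cite: PlatonovRapinchuk1994, §5.1] -/
theorem inv_mul_mem_I_of_eq_borel_mul_weyl_mul {ϖ : w.1.adicCompletion L}
    (hd : HermitianLattice.UnramifiedLocalConjDatum (galAdicCompletionMap (L := L) (IsCMField.complexConj L) hw) ϖ)
    (g₁ : GL (Fin 3) (w.1.adicCompletion L)) (hg₁ : (g₁ : Matrix (Fin 3) (Fin 3) (w.1.adicCompletion L)) = Matrix.diagonal ![(1 : w.1.adicCompletion L), 1, ϖ])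
    (K0 K1 I : Subgroup (Gqs L v))
    (hK0 : K0 = ((glInt 3 (w.1.adicCompletion L)).subgroupOf
      (unitaryGroupOfForm (galAdicCompletionMap (L := L) (IsCMField.complexConj L) hw) ((StdForm.antidiagonal 3).over (w.1.adicCompletion L)))).comap
        eA.toMulEquiv.toMonoidHom)
    (hK1 : K1 = (((glInt 3 (w.1.adicCompletion L)).map (MulAut.conj g₁).toMonoidHom).subgroupOf
      (unitaryGroupOfForm (galAdicCompletionMap (L := L) (IsCMField.complexConj L) hw) ((StdForm.antidiagonal 3).over (w.1.adicCompletion L)))).comap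
        eA.toMulEquiv.toMonoidHom)
    (hI : I = K0 ⊓ K1)
    (d : ↥(cmBorelTriple L 3 v).P) (hdK1 : (d : ↥(unitaryGroupOfForm (conjLocal L (IsCMField.complexConj L) v) (cmLocalForm L 3 v))) * (![(1 : ↥(unitaryGroupOfForm (conjLocal L (IsCMField.complexConj L) v) (cmLocalForm L 3 v))), eA.symm (weylLongU (galAdicCompletionMap (L := L) (IsCMField.complexConj L) hw) (rfl : (StdForm.antidiagonal 3).over (w.1.adicCompletion L) = _))] 1) ∈ K1)
    (h : ↥(cmBorelTriple L 3 v).P) (κ : ↥(unitaryGroupOfForm (conjLocal L (IsCMField.complexConj L) v) (cmLocalForm L 3 v))) (hκ : κ ∈ I)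
    (hk : (h : ↥(unitaryGroupOfForm (conjLocal L (IsCMField.complexConj L) v) (cmLocalForm L 3 v))) * (![(1 : ↥(unitaryGroupOfForm (conjLocal L (IsCMField.complexConj L) v) (cmLocalForm L 3 v))), eA.symm (weylLongU (galAdicCompletionMap (L := L) (IsCMField.complexConj L) hw) (rfl : (StdForm.antidiagonal 3).over (w.1.adicCompletion L) = _))] 1) * κ ∈ K1) :
    ((d : ↥(unitaryGroupOfForm (conjLocal L (IsCMField.complexConj L) v) (cmLocalForm L 3 v))) * (![(1 : ↥(unitaryGroupOfForm (conjLocal L (IsCMField.complexConj L) v) (cmLocalForm L 3 v))), eA.symm (weylLongU (galAdicCompletionMap (L := L) (IsCMField.complexConj L) hw) (rfl : (StdForm.antidiagonal 3).over (w.1.adicCompletion L) = _))] 1))⁻¹ *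
      ((h : ↥(unitaryGroupOfForm (conjLocal L (IsCMField.complexConj L) v) (cmLocalForm L 3 v))) * (![(1 : ↥(unitaryGroupOfForm (conjLocal L (IsCMField.complexConj L) v) (cmLocalForm L 3 v))), eA.symm (weylLongU (galAdicCompletionMap (L := L) (IsCMField.complexConj L) hw) (rfl : (StdForm.antidiagonal 3).over (w.1.adicCompletion L) = _))] 1) * κ) ∈ I := by
  subst hI
  let eU : ↥(unitaryGroupOfForm (conjLocal L (IsCMField.complexConj L) v) (cmLocalForm L 3 v)) ≃ₜ* ↥(unitaryGroupOfForm (galAdicCompletionMap (L := L) (IsCMField.complexConj L) hw) ((StdForm.antidiagonal 3).over (w.1.adicCompletion L))) := eA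
  have hdB : eU (d : ↥(unitaryGroupOfForm (conjLocal L (IsCMField.complexConj L) v) (cmLocalForm L 3 v))) ∈ borelU (galAdicCompletionMap (L := L) (IsCMField.complexConj L) hw) ((StdForm.antidiagonal 3).over (w.1.adicCompletion L)) :=
    (eA_mem_borelU_iff L v w hw eA heA _).2 d.2
  have hhB : eU (h : ↥(unitaryGroupOfForm (conjLocal L (IsCMField.complexConj L) v) (cmLocalForm L 3 v))) ∈ borelU (galAdicCompletionMap (L := L) (IsCMField.complexConj L) hw) ((StdForm.antidiagonal 3).over (w.1.adicCompletion L)) :=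
    (eA_mem_borelU_iff L v w hw eA heA _).2 h.2
  have hw1 : eU (![(1 : ↥(unitaryGroupOfForm (conjLocal L (IsCMField.complexConj L) v) (cmLocalForm L 3 v))), eA.symm (weylLongU (galAdicCompletionMap (L := L) (IsCMField.complexConj L) hw) (rfl : (StdForm.antidiagonal 3).over (w.1.adicCompletion L) = _))] 1) =
      weylLongU (galAdicCompletionMap (L := L) (IsCMField.complexConj L) hw) (rfl : (StdForm.antidiagonal 3).over (w.1.adicCompletion L) = _) := by
    have e := eA_vec L v w hw eA 1
    simpa using e
  have htw : eU (d : ↥(unitaryGroupOfForm (conjLocal L (IsCMField.complexConj L) v) (cmLocalForm L 3 v))) * weylLongU (galAdicCompletionMap (L := L) (IsCMField.complexConj L) hw) (rfl : (StdForm.antidiagonal 3).over (w.1.adicCompletion L) = _) ∈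
      ((glInt 3 (w.1.adicCompletion L)).map (MulAut.conj g₁).toMonoidHom).subgroupOf _ := by
    rw [← hw1, ← map_mul]
    exact (mem_comap_iff L v w hw eA _ _).1 (hK1 ▸ hdK1)
  have hκ' : eU κ ∈ (glInt 3 (w.1.adicCompletion L)).subgroupOf _ ⊓ ((glInt 3 (w.1.adicCompletion L)).map (MulAut.conj g₁).toMonoidHom).subgroupOf _ :=
    Subgroup.mem_inf.2 ⟨(mem_comap_iff L v w hw eA _ _).1 (hK0 ▸ (Subgroup.mem_inf.1 hκ).1), (mem_comap_iff L v w hw eA _ _).1 (hK1 ▸ (Subgroup.mem_inf.1 hκ).2)⟩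
  have hk' : eU (h : ↥(unitaryGroupOfForm (conjLocal L (IsCMField.complexConj L) v) (cmLocalForm L 3 v))) * weylLongU (galAdicCompletionMap (L := L) (IsCMField.complexConj L) hw) (rfl : (StdForm.antidiagonal 3).over (w.1.adicCompletion L) = _) * eU κ ∈
      ((glInt 3 (w.1.adicCompletion L)).map (MulAut.conj g₁).toMonoidHom).subgroupOf _ := by
    rw [← hw1, ← map_mul, ← map_mul]
    exact (mem_comap_iff L v w hw eA _ _).1 (hK1 ▸ hk)
  have hmodel := inv_mul_mem_inf_of_mem_borelU (galAdicCompletionMap (L := L) (IsCMField.complexConj L) hw) rfl hd.vσ hd.vϖ g₁ hg₁ hdB hhB htw hκ' hk'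
  -- pull back along `eA`
  have himg : eU (((d : ↥(unitaryGroupOfForm (conjLocal L (IsCMField.complexConj L) v) (cmLocalForm L 3 v))) * (![(1 : ↥(unitaryGroupOfForm (conjLocal L (IsCMField.complexConj L) v) (cmLocalForm L 3 v))), eA.symm (weylLongU (galAdicCompletionMap (L := L) (IsCMField.complexConj L) hw) (rfl : (StdForm.antidiagonal 3).over (w.1.adicCompletion L) = _))] 1))⁻¹ *
      ((h : ↥(unitaryGroupOfForm (conjLocal L (IsCMField.complexConj L) v) (cmLocalForm L 3 v))) * (![(1 : ↥(unitaryGroupOfForm (conjLocal L (IsCMField.complexConj L) v) (cmLocalForm L 3 v))), eA.symm (weylLongU (galAdicCompletionMap (L := L) (IsCMField.complexConj L) hw) (rfl : (StdForm.antidiagonal 3).over (w.1.adicCompletion L) = _))] 1) * κ)) =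
      (eU (d : ↥(unitaryGroupOfForm (conjLocal L (IsCMField.complexConj L) v) (cmLocalForm L 3 v))) * weylLongU (galAdicCompletionMap (L := L) (IsCMField.complexConj L) hw) (rfl : (StdForm.antidiagonal 3).over (w.1.adicCompletion L) = _))⁻¹ *
        (eU (h : ↥(unitaryGroupOfForm (conjLocal L (IsCMField.complexConj L) v) (cmLocalForm L 3 v))) * weylLongU (galAdicCompletionMap (L := L) (IsCMField.complexConj L) hw) (rfl : (StdForm.antidiagonal 3).over (w.1.adicCompletion L) = _) * eU κ) := by
    rw [map_mul, map_inv, map_mul, map_mul, map_mul, hw1]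
  refine Subgroup.mem_inf.2 ⟨?_, ?_⟩
  · rw [hK0]
    refine (mem_comap_iff L v w hw eA _ _).2 ?_
    change eU _ ∈ _
    rw [himg]
    exact (Subgroup.mem_inf.1 hmodel).1
  · rw [hK1]
    refine (mem_comap_iff L v w hw eA _ _).2 ?_
    change eU _ ∈ _
    rw [himg]
    exact (Subgroup.mem_inf.1 hmodel).2

include heA in
set_option maxHeartbeats 6400000 in
set_option synthInstance.maxHeartbeats 400000 in
-- instance-path unification between `Gqs L v` and the literal carrier of ★ `cmPrincipalSeries` (class of ★ II-2a §1)
/-- **Case (C): off the coset `(d w̃)·I` an `I`-fixed vector of an UNRAMIFIED `i_G(χ)` takes the value `f(1)` on `K₁`**: by Bruhat–Iwahori (★ FILE C `cover_borel_I`) `r = h·g·κ` with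
`h ∈ B_v`, `κ ∈ I`, `g ∈ {1, w̃}`; the cell `g = w̃` would put `r` in `(d w̃)·I` (the cell test); so `r = h κ` with `h = r κ⁻¹ ∈ B ∩ K₁`, where the inducing line is trivial
(★ PS-LEVELS `inducingLine_eq_one_of_mem_K1`), and `f(r) = σ_χ(h) f(κ) = f(κ) = f(1)` (★ II-2a `toFun_apply_of_mem_I`). [cite: BruhatTits1972, (4.4.3)–(4.4.4)] [cite: Casselman1980, §3] -/
theorem toFun_apply_of_inv_mul_not_mem_I {ϖ : w.1.adicCompletion L}
    (hd : HermitianLattice.UnramifiedLocalConjDatum (galAdicCompletionMap (L := L) (IsCMField.complexConj L) hw) ϖ)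
    (g₁ : GL (Fin 3) (w.1.adicCompletion L)) (hg₁ : (g₁ : Matrix (Fin 3) (Fin 3) (w.1.adicCompletion L)) = Matrix.diagonal ![(1 : w.1.adicCompletion L), 1, ϖ])
    (K0 K1 I : Subgroup (Gqs L v))
    (hK0 : K0 = ((glInt 3 (w.1.adicCompletion L)).subgroupOf
      (unitaryGroupOfForm (galAdicCompletionMap (L := L) (IsCMField.complexConj L) hw) ((StdForm.antidiagonal 3).over (w.1.adicCompletion L)))).comap
        eA.toMulEquiv.toMonoidHom)
    (hK1 : K1 = (((glInt 3 (w.1.adicCompletion L)).map (MulAut.conj g₁).toMonoidHom).subgroupOf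
      (unitaryGroupOfForm (galAdicCompletionMap (L := L) (IsCMField.complexConj L) hw) ((StdForm.antidiagonal 3).over (w.1.adicCompletion L)))).comap
        eA.toMulEquiv.toMonoidHom)
    (hI : I = K0 ⊓ K1)
    (χ : ↥(torusU (conjLocal L (IsCMField.complexConj L) v) (cmLocalForm L 3 v)) →* ℂˣ)
    (hU : ∀ t : ↥(torusU (conjLocal L (IsCMField.complexConj L) v) (cmLocalForm L 3 v)),
      (t : ↥(unitaryGroupOfForm (conjLocal L (IsCMField.complexConj L) v) (cmLocalForm L 3 v))) ∈ cmLocalIntegralLevel L 3 (qsForm L) v → χ t = 1)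
    (d : ↥(cmBorelTriple L 3 v).P) (hdK1 : (d : ↥(unitaryGroupOfForm (conjLocal L (IsCMField.complexConj L) v) (cmLocalForm L 3 v))) * (![(1 : ↥(unitaryGroupOfForm (conjLocal L (IsCMField.complexConj L) v) (cmLocalForm L 3 v))), eA.symm (weylLongU (galAdicCompletionMap (L := L) (IsCMField.complexConj L) hw) (rfl : (StdForm.antidiagonal 3).over (w.1.adicCompletion L) = _))] 1) ∈ K1) :
    haveI := locallyCompactSpace_cmBorelU L 3 v
    ∀ (f : Representation.SmoothInd (cmBorelTriple L 3 v).P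
        (Representation.twist (((Representation.trivial ℂ ↥(torusU (conjLocal L (IsCMField.complexConj L) v) (cmLocalForm L 3 v)) ℂ).twist χ).comp
          (cmBorelTriple L 3 v).proj) (rootDeltaChar (cmBorelTriple L 3 v).P))), f ∈ (cmPrincipalSeries L 3 v χ).fixedPoints I →
      ∀ r : ↥(unitaryGroupOfForm (conjLocal L (IsCMField.complexConj L) v) (cmLocalForm L 3 v)), r ∈ K1 →
        ((d : ↥(unitaryGroupOfForm (conjLocal L (IsCMField.complexConj L) v) (cmLocalForm L 3 v))) * (![(1 : ↥(unitaryGroupOfForm (conjLocal L (IsCMField.complexConj L) v) (cmLocalForm L 3 v))), eA.symm (weylLongU (galAdicCompletionMap (L := L) (IsCMField.complexConj L) hw) (rfl : (StdForm.antidiagonal 3).over (w.1.adicCompletion L) = _))] 1))⁻¹ * r ∉ I →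
        f.toFun r = f.toFun 1 := by
  haveI := locallyCompactSpace_cmBorelU L 3 v
  intro f hf r hrK1 hrI
  obtain ⟨i, h, κ, hκ, hr⟩ := cover_borel_I L v w hw eA heA hd g₁ hg₁ K0 K1 I hK0 hK1 hI r
  fin_cases i
  · -- cell `1`: `r = h κ`, `h = r κ⁻¹ ∈ B ∩ K₁`
    simp only [Fin.zero_eta, Matrix.cons_val_zero, mul_one] at hr
    have hhK1 : (h : ↥(unitaryGroupOfForm (conjLocal L (IsCMField.complexConj L) v) (cmLocalForm L 3 v))) ∈ K1 := by
      have e : (h : ↥(unitaryGroupOfForm (conjLocal L (IsCMField.complexConj L) v) (cmLocalForm L 3 v))) = r * κ⁻¹ := by rw [hr, mul_inv_cancel_right]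
      rw [e]
      exact K1.mul_mem hrK1 (K1.inv_mem (I_le_K1 L v K0 K1 I hI hκ))
    have hline := inducingLine_eq_one_of_mem_K1 L v w hw eA heA hd g₁ hg₁ K0 K1 I hK0 hK1 hI χ hU h hhK1
    rw [hr, Representation.SmoothInd.toFun_subgroup_mul f h, hline, Module.End.one_apply]
    exact toFun_apply_of_mem_I L v I χ f hf κ hκ
  · -- cell `w̃`: excluded by the cell test
    simp only [Fin.mk_one] at hr
    exfalso
    apply hrI
    have hk : (h : ↥(unitaryGroupOfForm (conjLocal L (IsCMField.complexConj L) v) (cmLocalForm L 3 v))) * (![(1 : ↥(unitaryGroupOfForm (conjLocal L (IsCMField.complexConj L) v) (cmLocalForm L 3 v))), eA.symm (weylLongU (galAdicCompletionMap (L := L) (IsCMField.complexConj L) hw) (rfl : (StdForm.antidiagonal 3).over (w.1.adicCompletion L) = _))] 1) * κ ∈ K1 := by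
      rw [← hr]; exact hrK1
    rw [hr]
    exact inv_mul_mem_I_of_eq_borel_mul_weyl_mul L v w hw eA heA hd g₁ hg₁ K0 K1 I hK0 hK1 hI d hdK1 h κ hκ hk

/-! ## §3 A left transversal of `K₁ ∕ I` meets the coset `(d w̃)·I` exactly once -/

open Classical in
/-- **`#(R′ ∩ (d w̃)·I) = 1`** for a left transversal `R′` of `K₁` modulo `K₁ ⊓ I` and `d w̃ ∈ K₁` (the representative of the coset of `d w̃`). [folklore] -/
theorem card_filter_inv_mul_mem_I_eq_one (K1 I : Subgroup (Gqs L v)) (R : Finset (Gqs L v)) (hR : IsLeftTransversal K1 (K1 ⊓ I) R)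
    (g : Gqs L v) (hg : g ∈ K1) :
    (R.filter fun r => g⁻¹ * r ∈ I).card = 1 := by
  obtain ⟨r₀, ⟨hr₀R, hr₀⟩, huniq⟩ := hR.existsUnique g hg
  have key : ∀ r : Gqs L v, g⁻¹ * r ∈ I ↔ r⁻¹ * g ∈ I := fun r => by
    rw [← I.inv_mem_iff, mul_inv_rev, inv_inv]
  refine Finset.card_eq_one.2 ⟨r₀, Finset.ext fun r => ?_⟩
  rw [Finset.mem_filter, Finset.mem_singleton]
  constructor
  · rintro ⟨hrR, hrI⟩
    exact huniq r ⟨hrR, Subgroup.mem_inf.2 ⟨K1.mul_mem (K1.inv_mem (hR.mem_of_mem r hrR)) hg, (key r).1 hrI⟩⟩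
  · intro hrr; rw [hrr]; exact ⟨hr₀R, (key r₀).2 (Subgroup.mem_inf.1 hr₀).2⟩

/-! ## §4 The `K₁`-average on the Iwahori plane -/

include heA in
set_option maxHeartbeats 12000000 in
set_option synthInstance.maxHeartbeats 400000 in
-- statement∕proof-heavy: the `SmoothInd` carrier of `cmPrincipalSeries`, averaging and II-1 (class of ★ II-2a §3)
/-- **`e_{K₁}(x f₁ + y f_w) = |R′|⁻¹ ((|R′| − 1) x + μ y) · (f₁ + μ⁻¹ f_w)`**, `μ = χ(proj d)·δ_B^{1∕2}(d)`, for the Iwahori pair `(f₁, f_w)` of an unramified `i_G(χ)`, any Borel `d`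
with `d w̃ ∈ K₁` and any left transversal `R′` of `K₁ ∕ I` (`|R′| = [K₁ : I]`): ★ `avgProj_eq` + §2 (values `μ y` on the coset `(d w̃)·I`, `x` elsewhere on `K₁`) + §3 + ★ II-1
`eq_smul_of_mem_fixedPoints_K1` (`e_{K₁} v ∈ V^{K₁} = ℂ(f₁ + μ⁻¹ f_w)`).  This is the `K₁`-datum `(a₁ : b₁) = ([K₁:I] − 1 : μ)`, `e₁ = f₁ + μ⁻¹ f_w`, `c = μ⁻¹` of ★
`criterion_of_iwahoriLine`. [cite: Casselman1980, §3] [cite: BernsteinZelevinsky1976, §2.3] [cite: BruhatTits1972, (4.4.3)] -/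
theorem avgProj_K1_eq {ϖ : w.1.adicCompletion L}
    (hd : HermitianLattice.UnramifiedLocalConjDatum (galAdicCompletionMap (L := L) (IsCMField.complexConj L) hw) ϖ)
    (g₁ : GL (Fin 3) (w.1.adicCompletion L)) (hg₁ : (g₁ : Matrix (Fin 3) (Fin 3) (w.1.adicCompletion L)) = Matrix.diagonal ![(1 : w.1.adicCompletion L), 1, ϖ])
    (K0 K1 I : Subgroup (Gqs L v))
    (hK0 : K0 = ((glInt 3 (w.1.adicCompletion L)).subgroupOf
      (unitaryGroupOfForm (galAdicCompletionMap (L := L) (IsCMField.complexConj L) hw) ((StdForm.antidiagonal 3).over (w.1.adicCompletion L)))).comap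
        eA.toMulEquiv.toMonoidHom)
    (hK1 : K1 = (((glInt 3 (w.1.adicCompletion L)).map (MulAut.conj g₁).toMonoidHom).subgroupOf
      (unitaryGroupOfForm (galAdicCompletionMap (L := L) (IsCMField.complexConj L) hw) ((StdForm.antidiagonal 3).over (w.1.adicCompletion L)))).comap
        eA.toMulEquiv.toMonoidHom)
    (hI : I = K0 ⊓ K1)
    (χ : ↥(torusU (conjLocal L (IsCMField.complexConj L) v) (cmLocalForm L 3 v)) →* ℂˣ)
    (hU : ∀ t : ↥(torusU (conjLocal L (IsCMField.complexConj L) v) (cmLocalForm L 3 v)),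
      (t : ↥(unitaryGroupOfForm (conjLocal L (IsCMField.complexConj L) v) (cmLocalForm L 3 v))) ∈ cmLocalIntegralLevel L 3 (qsForm L) v → χ t = 1)
    (d : ↥(cmBorelTriple L 3 v).P) (hdK1 : (d : ↥(unitaryGroupOfForm (conjLocal L (IsCMField.complexConj L) v) (cmLocalForm L 3 v))) * (![(1 : ↥(unitaryGroupOfForm (conjLocal L (IsCMField.complexConj L) v) (cmLocalForm L 3 v))), eA.symm (weylLongU (galAdicCompletionMap (L := L) (IsCMField.complexConj L) hw) (rfl : (StdForm.antidiagonal 3).over (w.1.adicCompletion L) = _))] 1) ∈ K1)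
    (R : Finset (Gqs L v)) (hR : IsLeftTransversal K1 (K1 ⊓ I) R) :
    haveI := locallyCompactSpace_cmBorelU L 3 v
    ∀ (f₁ f_w : Representation.SmoothInd (cmBorelTriple L 3 v).P
        (Representation.twist (((Representation.trivial ℂ ↥(torusU (conjLocal L (IsCMField.complexConj L) v) (cmLocalForm L 3 v)) ℂ).twist χ).comp
          (cmBorelTriple L 3 v).proj) (rootDeltaChar (cmBorelTriple L 3 v).P))),
      f₁ ∈ (cmPrincipalSeries L 3 v χ).fixedPoints I → f_w ∈ (cmPrincipalSeries L 3 v χ).fixedPoints I →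
      f₁.toFun 1 = 1 →
      f₁.toFun (eA.symm (weylLongU (galAdicCompletionMap (L := L) (IsCMField.complexConj L) hw) (rfl : (StdForm.antidiagonal 3).over (w.1.adicCompletion L) = _))) = 0 →
      f_w.toFun 1 = 0 →
      f_w.toFun (eA.symm (weylLongU (galAdicCompletionMap (L := L) (IsCMField.complexConj L) hw) (rfl : (StdForm.antidiagonal 3).over (w.1.adicCompletion L) = _))) = 1 →
      ∀ x y : ℂ, Representation.avgProj (G := Gqs L v) (cmPrincipalSeries L 3 v χ) K1 (x • f₁ + y • f_w) =
        ((R.card : ℂ)⁻¹ * (((R.card : ℂ) - 1) * x + (((χ ((cmBorelTriple L 3 v).proj d) : ℂˣ) : ℂ) * ((rootDeltaChar (cmBorelTriple L 3 v).P d : ℂˣ) : ℂ)) * y)) •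
          (f₁ + (((χ ((cmBorelTriple L 3 v).proj d) : ℂˣ) : ℂ) * ((rootDeltaChar (cmBorelTriple L 3 v).P d : ℂˣ) : ℂ))⁻¹ • f_w) := by
  classical
  haveI := locallyCompactSpace_cmBorelU L 3 v
  intro f₁ f_w hf₁ hf_w h11 h1w hw1 hww x y
  obtain ⟨g, hgdef⟩ : ∃ g : Gqs L v, g = (d : ↥(unitaryGroupOfForm (conjLocal L (IsCMField.complexConj L) v) (cmLocalForm L 3 v))) * (![(1 : ↥(unitaryGroupOfForm (conjLocal L (IsCMField.complexConj L) v) (cmLocalForm L 3 v))), eA.symm (weylLongU (galAdicCompletionMap (L := L) (IsCMField.complexConj L) hw) (rfl : (StdForm.antidiagonal 3).over (w.1.adicCompletion L) = _))] 1) := ⟨_, rfl⟩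
  have hgK1 : g ∈ K1 := hgdef ▸ hdK1
  have hlev := isOpen_isCompact_levels L v w hw eA g₁ K0 K1 I hK0 hK1 hI
  have hK1c : IsCompact (K1 : Set (Gqs L v)) := hlev.2.1.2
  have hIo : IsOpen (I : Set (Gqs L v)) := hlev.2.2.1
  -- `v = x f₁ + y f_w` is `I`-fixed, hence smooth, and `e_{K₁} v` is a finite average (★ `avgProj_eq`)
  have hv : x • f₁ + y • f_w ∈ (cmPrincipalSeries L 3 v χ).fixedPoints I := Submodule.add_mem _ (Submodule.smul_mem _ _ hf₁) (Submodule.smul_mem _ _ hf_w)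
  have hTv : ∀ t ∈ I, (cmPrincipalSeries L 3 v χ) t (x • f₁ + y • f_w) = x • f₁ + y • f_w := fun t ht => (Representation.mem_fixedPoints _ _ _).1 hv t ht
  have havg := Representation.avgProj_eq (G := Gqs L v) (ρ := cmPrincipalSeries L 3 v χ) hK1c hIo hTv hR
  have hsm : Representation.IsSmoothVector (G := Gqs L v) (cmPrincipalSeries L 3 v χ) (x • f₁ + y • f_w) :=
    F0P2pCmPrincipalSeriesInterface.isSmooth_cmPrincipalSeries L v χ _
  have hmem := Representation.avgProj_mem_fixedPoints (G := Gqs L v) (ρ := cmPrincipalSeries L 3 v χ) hK1c hsm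
  -- `e_{K₁} v ∈ V^{K₁} = ℂ(f₁ + μ⁻¹ f_w)` (★ II-1)
  have hline := eq_smul_of_mem_fixedPoints_K1 L v w hw eA heA hd g₁ hg₁ K0 K1 I hK0 hK1 hI χ d hdK1 f₁ f_w _ hf₁ hf_w hmem h11 h1w hw1 hww
  -- values: `v(1) = x`, `v(w̃) = y`; `(r·v)(1) = v(r) = μ y` on `(d w̃)·I`, `= x` elsewhere on `K₁`
  have hv1 : (x • f₁ + y • f_w).toFun 1 = x := by
    simp [Representation.SmoothInd.toFun_add, Representation.SmoothInd.toFun_smul, h11, hw1]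
  have hvw : (x • f₁ + y • f_w).toFun (eA.symm (weylLongU (galAdicCompletionMap (L := L) (IsCMField.complexConj L) hw) (rfl : (StdForm.antidiagonal 3).over (w.1.adicCompletion L) = _))) = y := by
    simp [Representation.SmoothInd.toFun_add, Representation.SmoothInd.toFun_smul, h1w, hww]
  have hval : ∀ r ∈ R, ((cmPrincipalSeries L 3 v χ) r (x • f₁ + y • f_w)).toFun 1 =
      if g⁻¹ * r ∈ I then
        (((χ ((cmBorelTriple L 3 v).proj d) : ℂˣ) : ℂ) * ((rootDeltaChar (cmBorelTriple L 3 v).P d : ℂˣ) : ℂ)) * y else x := by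
    intro r hr
    have e : ((cmPrincipalSeries L 3 v χ) r (x • f₁ + y • f_w)).toFun 1 = (x • f₁ + y • f_w).toFun r := by
      have h := Representation.toFun_smoothIndRep_apply (show ↥(unitaryGroupOfForm (conjLocal L (IsCMField.complexConj L) v) (cmLocalForm L 3 v)) from r) (x • f₁ + y • f_w) 1
      rw [one_mul] at h
      exact h
    rw [e]
    by_cases hrI : g⁻¹ * r ∈ I
    · rw [if_pos hrI, toFun_apply_of_inv_mul_mem_I L v w hw eA I χ d _ hv r (hgdef ▸ hrI), hvw]
    · rw [if_neg hrI, toFun_apply_of_inv_mul_not_mem_I L v w hw eA heA hd g₁ hg₁ K0 K1 I hK0 hK1 hI χ hU d hdK1 _ hv r (hR.mem_of_mem r hr) (hgdef ▸ hrI), hv1]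
  -- the scalar `(e_{K₁} v)(1) = |R|⁻¹ Σ_r v(r) = |R|⁻¹ ((|R| − 1) x + μ y)`
  have hone : (R.filter fun r => g⁻¹ * r ∈ I).card = 1 :=
    card_filter_inv_mul_mem_I_eq_one L v K1 I R hR g hgK1
  have hR1 : 1 ≤ R.card := hone ▸ Finset.card_filter_le R _
  have hrest : (R.filter fun r => ¬ g⁻¹ * r ∈ I).card = R.card - 1 := by
    have h := Finset.card_filter_add_card_filter_not (s := R) (fun r => g⁻¹ * r ∈ I)
    omega
  have hsum : ∑ r ∈ R, ((cmPrincipalSeries L 3 v χ) r (x • f₁ + y • f_w)).toFun 1 =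
      ((R.card : ℂ) - 1) * x + (((χ ((cmBorelTriple L 3 v).proj d) : ℂˣ) : ℂ) * ((rootDeltaChar (cmBorelTriple L 3 v).P d : ℂˣ) : ℂ)) * y := by
    rw [Finset.sum_congr rfl hval, Finset.sum_ite, Finset.sum_const, Finset.sum_const, hone, hrest, one_smul, nsmul_eq_mul,
      Nat.cast_sub hR1, Nat.cast_one]
    ring
  have hscal : (Representation.avgProj (G := Gqs L v) (cmPrincipalSeries L 3 v χ) K1 (x • f₁ + y • f_w)).toFun 1 =
      (R.card : ℂ)⁻¹ * (((R.card : ℂ) - 1) * x + (((χ ((cmBorelTriple L 3 v).proj d) : ℂˣ) : ℂ) * ((rootDeltaChar (cmBorelTriple L 3 v).P d : ℂˣ) : ℂ)) * y) := by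
    have h1 := congrArg (fun u => Representation.SmoothInd.toFun u 1) havg
    simp only [Representation.SmoothInd.toFun_smul, Pi.smul_apply, Representation.SmoothInd.toFun_sum, smul_eq_mul] at h1
    -- the two spellings of the sum (`G_v` read as `Gqs L v` ∕ as the matrix carrier) agree term by term, definitionally
    refine h1.trans (Eq.trans ?_ (congrArg (fun z : ℂ => (R.card : ℂ)⁻¹ * z) hsum))
    exact congrArg (fun z : ℂ => (R.card : ℂ)⁻¹ * z) (Finset.sum_congr rfl fun r _ => rfl)
  exact hline.trans (congrArg (fun t : ℂ => t • (f₁ + (((χ ((cmBorelTriple L 3 v).proj d) : ℂˣ) : ℂ) * ((rootDeltaChar (cmBorelTriple L 3 v).P d : ℂˣ) : ℂ))⁻¹ • f_w)) hscal)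

end Summit.HodgeConjecture.HodgeConjecture.Cruxes.H413.K2E3ParahoricAverageK1

end
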